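import Literature.AnabelianGeometry.SemiGraphs.BTempQDPairHomHat
import HarnessLib

/-!
# Semi-graphs of anabelioids, Appendix, proof of Theorem A.4: transport of `Hom^` along
# isomorphisms of QD-pairs, and invariance under `Γ_B`, `Γ_C`

Mochizuki, *Semi-graphs of anabelioids*, Publ. RIMS **42** (2006) 221–322, Appendix, proof of
Theorem A.4, manuscript p. 84 (PRIMS p. 314 l. 9 – l. 18)
[cite: MochizukiSemiAnbd2006, Thm A.4 proof p.84]: "Next, suppose that `(B, Γ_B)`, `(C, Γ_C)` are
weakly connected QD-pairs. Then observe that each connected component `B′` of `B` determines a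
strongly connected QD-pair `(B′, Γ_B′)` … Moreover, if `B′`, `B″` (respectively, `C′`, `C″`) are
connected components of `B` (respectively, `C`), then one verifies immediately that any choice of
elements `γ_B ∈ Γ_B`, `γ_C ∈ Γ_C` such that `γ_B(B′) = B″`, `γ_C(C′) = C″` determines a bijection
`Hom^((B′, Γ_B′), (C′, Γ_C′)) ⥲ Hom^((B″, Γ_B″), (C″, Γ_C″))` which is, in fact, independent of the
choice of `γ_B`, `γ_C`."

Row **A4-lim-wc** of `plan/L3/SUBDAG-SemiAnbd-Cor311.md` (seat abc-iut-w4-d089), part 1 — the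
CATEGORY-GENERAL half of that sentence, over `QDPair.HomHat` (`BTempQDPairHomHat.lean`): the
elements `γ_B`, `γ_C` act through ISOMORPHISMS OF QD-PAIRS `(B′, Γ_B′) ⥲ (B″, Γ_B″)`,
`(C′, Γ_C′) ⥲ (C″, Γ_C″)`, and two choices differ by AUTOMORPHISMS of the pairs given by elements
of `Γ_B″`, `Γ_C″`; so the printed bijection and its independence of the choices are two facts about
`Hom^` valid in ANY category:
* `QDPair.HomHat.map (e : P ≅ P′) (g : C ⟶ C′) : Hom^(P, C) → Hom^(P′, C′)` — a 1-proper cover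
  `(B‴, Γ) → (B′, Γ_B′)` becomes `(B‴, Γ) → (B′, Γ_B′) ⥲ (B″, Γ_B″)` (`OneProperCover.transport`;
  isomorphisms of QD-pairs are 1-proper, `isOneProper_iso`, and 1-properness is stable under them,
  `Hom.IsOneProper.comp_iso`) and `f̄ ∈ Hom̄` is post-composed with `g` (`HomBar.postcomp`);
  `map_refl`, `map_trans`, hence the bijection `HomHat.map_bijective` / `HomHat.equivOfIso`;
* **`QDPair.HomHat.map_autOfMem`** — INVARIANCE: for `γ ∈ Γ_B`, `δ ∈ Γ_C` acting as automorphisms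
  of the QD-pairs (`QDPair.autOfMem`), `HomHat.map` is the identity (intrinsic proof: `γ` lifts
  along each 1-proper cover `(B‴, Γ_B‴) → (B, Γ_B)` to some `γ‴ ∈ Γ_B‴` — Def. A.3 (iv) — which is a
  transition of covers, and `γ‴ ≫ f ∼ f ∼ f ≫ δ` in `Hom̄` since `f` is a morphism of QD-pairs).
Also: `QDPair.isoA` (underlying isomorphism), `QDPair.isoOfConj` (an isomorphism of objects
conjugating `Γ` onto `Γ′` is an isomorphism of pairs), and for a strongly connected pair the identity
cover `OneProperCover.self` with the natural map `Hom_D → Hom^`, `QDPair.homHatOfHom` (p. 84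
l. −6: "it follows immediately from the definitions that we have a natural map").  The `B^temp(Π)`
half (components `(B′, Γ_B′)`, `q((B′, Γ_B′)) ≅ q((B, Γ_B))`, the matching families) is the companion
`BTempQDPairComponents.lean`.  Elementary; nothing refers to the IUT corpus; no side is taken on any
disputed claim.
-/

open CategoryTheory

namespace Literature.AnabelianGeometry.SemiGraphs

universe v₁ u₁

namespace QDPair

variable {Q : Type u₁} [Category.{v₁} Q]

/-! ### Isomorphisms of QD-pairs -/

/-- The underlying isomorphism `B ≅ B′` of an isomorphism of QD-pairs `(B, Γ_B) ≅ (B′, Γ_B′)`.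
[cite: MochizukiSemiAnbd2006, Def A.3(ii) p.82] -/
def isoA {P P' : QDPair Q} (e : P ≅ P') : P.A ≅ P'.A where
  hom := e.hom.hom
  inv := e.inv.hom
  hom_inv_id := by
    have h := congrArg Hom.hom e.hom_inv_id
    exact h
  inv_hom_id := by
    have h := congrArg Hom.hom e.inv_hom_id
    exact h

/-- `e.hom ≫ e.inv = 𝟙` on underlying arrows. [cite: MochizukiSemiAnbd2006, Def A.3(ii) p.82] -/
@[simp] theorem iso_hom_inv_id_hom {P P' : QDPair Q} (e : P ≅ P') :
    e.hom.hom ≫ e.inv.hom = 𝟙 P.A :=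
  (isoA e).hom_inv_id

/-- `e.inv ≫ e.hom = 𝟙` on underlying arrows. [cite: MochizukiSemiAnbd2006, Def A.3(ii) p.82] -/
@[simp] theorem iso_inv_hom_id_hom {P P' : QDPair Q} (e : P ≅ P') :
    e.inv.hom ≫ e.hom.hom = 𝟙 P'.A :=
  (isoA e).inv_hom_id

/-- Elements of `Γ_B′` LIFT along an isomorphism of QD-pairs `(B, Γ_B) ⥲ (B′, Γ_B′)`: for
`γ′ ∈ Γ_B′` there is `γ ∈ Γ_B` with `e ≫ γ′ = γ ≫ e` (descend `γ′` along `e⁻¹`).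
[cite: MochizukiSemiAnbd2006, Def A.3(ii) p.82] -/
theorem exists_lift_of_iso {P P' : QDPair Q} (e : P ≅ P') {γ' : Aut P'.A} (hγ' : γ' ∈ P'.Γ) :
    ∃ γ ∈ P.Γ, e.hom.hom ≫ γ'.hom = γ.hom ≫ e.hom.hom := by
  obtain ⟨γ, hγ, h⟩ := e.inv.comm γ' hγ'
  -- `h : e.inv.hom ≫ γ.hom = γ'.hom ≫ e.inv.hom`
  refine ⟨γ, hγ, ?_⟩
  have h' := congrArg (fun φ => e.hom.hom ≫ φ ≫ e.hom.hom) h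
  simp only [Category.assoc, iso_inv_hom_id_hom, Category.comp_id] at h'
  rw [← Category.assoc, iso_hom_inv_id_hom, Category.id_comp] at h'
  exact h'.symm

/-- **An isomorphism of objects conjugating `Γ_B` onto `Γ_B′` is an isomorphism of QD-pairs.**
[cite: MochizukiSemiAnbd2006, Def A.3(ii) p.82] -/
def isoOfConj {P P' : QDPair Q} (ε : P.A ≅ P'.A) (h₁ : ∀ γ ∈ P.Γ, ε.conjAut γ ∈ P'.Γ)
    (h₂ : ∀ γ' ∈ P'.Γ, ε.symm.conjAut γ' ∈ P.Γ) : P ≅ P' where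
  hom := ⟨ε.hom, fun γ hγ => ⟨ε.conjAut γ, h₁ γ hγ, by simp [Iso.conjAut_hom, Iso.conj_apply]⟩⟩
  inv := ⟨ε.inv, fun γ' hγ' => ⟨ε.symm.conjAut γ', h₂ γ' hγ', by simp [Iso.conjAut_hom, Iso.conj_apply]⟩⟩
  hom_inv_id := Hom.ext ε.hom_inv_id
  inv_hom_id := Hom.ext ε.inv_hom_id

/-- Conjugation by `α ∈ Aut(B)` in the automorphism group: `α.conjAut f = α * f * α⁻¹`. [folklore] -/
private theorem conjAut_eq_mul_mul_inv {X : Q} (α f : Aut X) : α.conjAut f = α * f * α⁻¹ :=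
  Iso.ext (by simp [Iso.conjAut_hom, Iso.conj_apply, Aut.Aut_mul_def, Aut.Aut_inv_def])

/-- **An element `γ ∈ Γ_B` is an automorphism of the QD-pair `(B, Γ_B)`** (it conjugates `Γ_B` onto
itself). [cite: MochizukiSemiAnbd2006, Def A.3(ii) p.82] -/
def autOfMem (P : QDPair Q) (γ : Aut P.A) (hγ : γ ∈ P.Γ) : P ≅ P :=
  isoOfConj γ
    (fun δ hδ => by
      rw [conjAut_eq_mul_mul_inv]
      exact P.Γ.mul_mem (P.Γ.mul_mem hγ hδ) (P.Γ.inv_mem hγ))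
    (fun δ hδ => by
      rw [conjAut_eq_mul_mul_inv]
      have hγ' : γ.symm ∈ P.Γ := by
        rw [← Aut.Aut_inv_def]
        exact P.Γ.inv_mem hγ
      exact P.Γ.mul_mem (P.Γ.mul_mem hγ' hδ) (P.Γ.inv_mem hγ'))

/-- `autOfMem` on the underlying arrow. [cite: MochizukiSemiAnbd2006, Def A.3(ii) p.82] -/
@[simp] theorem autOfMem_hom_hom (P : QDPair Q) (γ : Aut P.A) (hγ : γ ∈ P.Γ) :
    (autOfMem P γ hγ).hom.hom = γ.hom := rfl

/-- `autOfMem` on the underlying inverse arrow. [cite: MochizukiSemiAnbd2006, Def A.3(ii) p.82] -/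
@[simp] theorem autOfMem_inv_hom (P : QDPair Q) (γ : Aut P.A) (hγ : γ ∈ P.Γ) :
    (autOfMem P γ hγ).inv.hom = γ.inv := rfl

/-! ### Isomorphisms of QD-pairs are 1-proper; 1-properness is stable under them -/

/-- Components are stable under post-composition with an isomorphism (as in
`IsComponent.comp_iso` of `QuasiTemperoidsRmkA31Proofs`, restated privately to keep the imports of
this file small). [cite: MochizukiSemiAnbd2006, Def A.3(i) p.82] -/
private theorem isComponent_comp_iso' {X A A' : Q} {ι : X ⟶ A} (h : IsComponent ι) (i : A ≅ A') :
    IsComponent (ι ≫ i.hom) := by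
  obtain ⟨hX, B, κ, ⟨hc⟩⟩ := h
  refine ⟨hX, B, κ ≫ i.hom, ⟨Limits.IsColimit.ofIsoColimit hc (Limits.Cocone.ext i ?_)⟩⟩
  rintro ⟨⟨⟩⟩ <;> rfl


/-- The stabiliser (Def. A.3 (iv): "`Ker(Γ_A ↠ Γ_B)`") is unchanged by an isomorphism of the
target. [cite: MochizukiSemiAnbd2006, Def A.3(iv) p.82] -/
theorem Hom.stabilizer_comp_iso {P₁ P₂ P₃ : QDPair Q} (f : P₁ ⟶ P₂) (e : P₂ ≅ P₃) :
    Hom.stabilizer (f ≫ e.hom) = Hom.stabilizer f := by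
  ext γ
  change γ ∈ P₁.Γ ∧ γ.hom ≫ f.hom ≫ e.hom.hom = f.hom ≫ e.hom.hom ↔ γ ∈ P₁.Γ ∧ γ.hom ≫ f.hom = f.hom
  haveI : Mono e.hom.hom := (inferInstance : Mono (isoA e).hom)
  rw [← Category.assoc, cancel_mono]

/-- **Isomorphisms of QD-pairs are 1-proper** (0-proper: a component of `B′` pulls back to a
component of `B`; every `γ′ ∈ Γ_B′` lifts; `B → B′` forms a quotient of `(B, Ker) = (B, {1})`).
[cite: MochizukiSemiAnbd2006, Def A.3(iv) p.82] -/
theorem isOneProper_iso {P P' : QDPair Q} (e : P ≅ P') : Hom.IsOneProper e.hom := by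
  refine ⟨?_, fun γ' hγ' => exists_lift_of_iso e hγ', ?_⟩
  · intro D κ hκ
    refine ⟨D, κ ≫ (isoA e).inv, 𝟙 D, isComponent_comp_iso' hκ (isoA e).symm, ?_⟩
    rw [Category.id_comp, Category.assoc]
    change κ ≫ (isoA e).inv ≫ (isoA e).hom = κ
    rw [(isoA e).inv_hom_id, Category.comp_id]
  · refine ⟨fun γ hγ => hγ.2, fun C ψ _ => ?_⟩
    refine ⟨e.inv.hom ≫ ψ, ?_, fun χ hχ => ?_⟩
    · change e.hom.hom ≫ e.inv.hom ≫ ψ = ψ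
      rw [← Category.assoc, iso_hom_inv_id_hom, Category.id_comp]
    · rw [← hχ]
      change χ = e.inv.hom ≫ e.hom.hom ≫ χ
      rw [← Category.assoc, iso_inv_hom_id_hom, Category.id_comp]

/-- **1-properness is stable under post-composition with an isomorphism of QD-pairs.**
[cite: MochizukiSemiAnbd2006, Def A.3(iv) p.82] -/
theorem Hom.IsOneProper.comp_iso {P₁ P₂ P₃ : QDPair Q} {f : P₁ ⟶ P₂} (hf : Hom.IsOneProper f)
    (e : P₂ ≅ P₃) : Hom.IsOneProper (f ≫ e.hom) := by
  obtain ⟨h0, hlift, hquot⟩ := hf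
  refine ⟨?_, ?_, ?_⟩
  · intro D κ hκ
    obtain ⟨C, ι, h, hι, hsq⟩ := h0 (κ ≫ (isoA e).inv) (isComponent_comp_iso' hκ (isoA e).symm)
    refine ⟨C, ι, h, hι, ?_⟩
    change ι ≫ f.hom ≫ (isoA e).hom = h ≫ κ
    rw [← Category.assoc, hsq, Category.assoc, Category.assoc, (isoA e).inv_hom_id,
      Category.comp_id]
  · intro γ₃ hγ₃
    obtain ⟨γ₂, hγ₂, h₂⟩ := exists_lift_of_iso e hγ₃
    obtain ⟨γ₁, hγ₁, h₁⟩ := hlift γ₂ hγ₂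
    refine ⟨γ₁, hγ₁, ?_⟩
    change (f.hom ≫ e.hom.hom) ≫ γ₃.hom = γ₁.hom ≫ f.hom ≫ e.hom.hom
    rw [Category.assoc, h₂, ← Category.assoc, h₁, Category.assoc]
  · rw [Hom.stabilizer_comp_iso f e]
    exact hquot.of_iso (isoA e)

/-! ### Transport of 1-proper covers and of `Hom̄` -/

/-- **Transport of a 1-proper cover along an isomorphism of QD-pairs**: `(B‴, Γ) → (B′, Γ_B′)`
becomes `(B‴, Γ) → (B′, Γ_B′) ⥲ (B″, Γ_B″)`. [cite: MochizukiSemiAnbd2006, Thm A.4 proof p.84] -/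
@[reducible] def OneProperCover.transport {P P' : QDPair Q} (c : OneProperCover P) (e : P ≅ P') :
    OneProperCover P' where
  src := c.src
  hom := c.hom ≫ e.hom
  isStronglyConnected := c.isStronglyConnected
  isOneProper := c.isOneProper.comp_iso e

/-- The transported cover's arrow. [cite: MochizukiSemiAnbd2006, Thm A.4 proof p.84] -/
@[simp] theorem OneProperCover.transport_hom {P P' : QDPair Q} (c : OneProperCover P)
    (e : P ≅ P') : (c.transport e).hom = c.hom ≫ e.hom := rfl

/-- Transitions are transported along with the covers (same arrow).
[cite: MochizukiSemiAnbd2006, Thm A.4 proof p.84] -/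
@[reducible] def OneProperCover.Transition.transport {P P' : QDPair Q} {c c' : OneProperCover P}
    (t : OneProperCover.Transition c c') (e : P ≅ P') :
    OneProperCover.Transition (c.transport e) (c'.transport e) where
  hom := t.hom
  w := by
    change t.hom ≫ c'.hom ≫ e.hom = c.hom ≫ e.hom
    rw [← Category.assoc, t.w]
  isOneProper := t.isOneProper

/-- For a strongly connected QD-pair, **the identity is a 1-proper cover** of it.
[cite: MochizukiSemiAnbd2006, Thm A.4 proof p.84] -/
@[reducible] def OneProperCover.self (P : QDPair Q) (hP : P.IsStronglyConnected) : OneProperCover P where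
  src := P
  hom := (Iso.refl P).hom
  isStronglyConnected := hP
  isOneProper := isOneProper_iso (Iso.refl P)

/-- **The natural map `Hom_D((B, Γ_B), (C, Γ_C)) → Hom^((B, Γ_B), (C, Γ_C))`** for `(B, Γ_B)`
strongly connected: `f ↦ [(B = B, f̄)]` ("it follows immediately from the definitions that we have a
natural map", p. 84). [cite: MochizukiSemiAnbd2006, Thm A.4 proof p.84] -/
def homHatOfHom {P C : QDPair Q} (hP : P.IsStronglyConnected) (f : P ⟶ C) : HomHat P C :=
  homHatMk (OneProperCover.self P hP) (homBarMk f)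

/-- `Hom̄` is covariant in the target along ANY morphism of QD-pairs `g : (C, Γ_C) → (C′, Γ_C′)`
(every `γ ∈ Γ_C` descends along `g`, Def. A.3 (ii)). [cite: MochizukiSemiAnbd2006, Thm A.4 proof p.84] -/
def HomBar.postcomp {P₁ P₂ P₂' : QDPair Q} (g : P₂ ⟶ P₂') : HomBar P₁ P₂ → HomBar P₁ P₂' :=
  Quotient.map' (fun f => f ≫ g) (by
    rintro f f' ⟨γ, hγ, h⟩
    obtain ⟨γ', hγ', h'⟩ := g.comm γ hγ
    refine ⟨γ', hγ', ?_⟩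
    change f'.hom ≫ g.hom = (f.hom ≫ g.hom) ≫ γ'.hom
    rw [h, Category.assoc, Category.assoc, h'])

/-- Post-composition on classes. [cite: MochizukiSemiAnbd2006, Thm A.4 proof p.84] -/
@[simp] theorem HomBar.postcomp_mk {P₁ P₂ P₂' : QDPair Q} (g : P₂ ⟶ P₂') (f : P₁ ⟶ P₂) :
    HomBar.postcomp g (homBarMk f) = homBarMk (f ≫ g) := rfl

/-- Pre- and post-composition on `Hom̄` commute. [cite: MochizukiSemiAnbd2006, Thm A.4 proof p.84] -/
theorem HomBar.postcomp_precomp {P₁ P₁' P₂ P₂' : QDPair Q} (h : P₁' ⟶ P₁) (g : P₂ ⟶ P₂')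
    (x : HomBar P₁ P₂) :
    HomBar.postcomp g (HomBar.precomp h x) = HomBar.precomp h (HomBar.postcomp g x) := by
  induction x using Quotient.ind with
  | _ f =>
    change homBarMk ((h ≫ f) ≫ g) = homBarMk (h ≫ f ≫ g)
    rw [Category.assoc]

/-- An element of `Γ_C`, acting as an automorphism of `(C, Γ_C)`, does not change classes in
`Hom̄ = Hom_D/Γ_C`. [cite: MochizukiSemiAnbd2006, Thm A.4 proof p.83] -/
theorem HomBar.postcomp_autOfMem {P C : QDPair Q} {δ : Aut C.A} (hδ : δ ∈ C.Γ) (x : HomBar P C) :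
    HomBar.postcomp (autOfMem C δ hδ).hom x = x := by
  induction x using Quotient.ind with
  | _ f =>
    change homBarMk (f ≫ (autOfMem C δ hδ).hom) = homBarMk f
    rw [homBarMk_eq_iff]
    refine ⟨δ⁻¹, C.Γ.inv_mem hδ, ?_⟩
    change f.hom = (f.hom ≫ δ.hom) ≫ δ.inv
    rw [Category.assoc, δ.hom_inv_id, Category.comp_id]

/-- For an automorphism `γ‴ ∈ Γ_B‴` of the source, `γ‴ ≫ f ∼ f` in `Hom̄` (because `f` is a
morphism of QD-pairs: `γ‴ ≫ f = f ≫ γ_C`). [cite: MochizukiSemiAnbd2006, Thm A.4 proof p.83] -/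
theorem HomBar.precomp_autOfMem {P C : QDPair Q} {γ : Aut P.A} (hγ : γ ∈ P.Γ) (x : HomBar P C) :
    HomBar.precomp (autOfMem P γ hγ).hom x = x := by
  induction x using Quotient.ind with
  | _ f =>
    change homBarMk ((autOfMem P γ hγ).hom ≫ f) = homBarMk f
    obtain ⟨γ', hγ', h⟩ := f.comm γ hγ
    rw [homBarMk_eq_iff]
    refine ⟨γ'⁻¹, C.Γ.inv_mem hγ', ?_⟩
    change f.hom = (γ.hom ≫ f.hom) ≫ γ'.inv
    rw [← h, Category.assoc, γ'.hom_inv_id, Category.comp_id]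

/-! ### Transport of `Hom^` along isomorphisms of QD-pairs -/

/-- **`Hom^` is functorial in isomorphisms of the source and morphisms of the target**:
`[(B‴ → B′, f̄)] ↦ [(B‴ → B′ ⥲ B″, f̄ ≫ g)]`. [cite: MochizukiSemiAnbd2006, Thm A.4 proof p.84] -/
def HomHat.map {P P' C C' : QDPair Q} (e : P ≅ P') (g : C ⟶ C') : HomHat P C → HomHat P' C' :=
  Quot.lift (fun a => homHatMk (a.1.transport e) (HomBar.postcomp g a.2)) (by
    rintro ⟨c', x⟩ ⟨c, y⟩ ⟨t, h⟩
    dsimp only at t h ⊢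
    subst h
    have key := homHatMk_precomp (t.transport e) (HomBar.postcomp g x)
    have hpp : HomBar.precomp (t.transport e).hom (HomBar.postcomp g x) =
        HomBar.postcomp g (HomBar.precomp t.hom x) :=
      (HomBar.postcomp_precomp t.hom g x).symm
    rw [hpp] at key
    exact key.symm)

/-- `HomHat.map` on a class. [cite: MochizukiSemiAnbd2006, Thm A.4 proof p.84] -/
@[simp] theorem HomHat.map_mk {P P' C C' : QDPair Q} (e : P ≅ P') (g : C ⟶ C')
    (c : OneProperCover P) (x : HomBar c.src C) :
    HomHat.map e g (homHatMk c x) = homHatMk (c.transport e) (HomBar.postcomp g x) := rfl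

/-- **`HomHat.map` along the identity is the identity.** [cite: MochizukiSemiAnbd2006, Thm A.4 proof p.84] -/
theorem HomHat.map_refl {P C : QDPair Q} (x : HomHat P C) : HomHat.map (Iso.refl P) (𝟙 C) x = x := by
  obtain ⟨⟨c, y⟩, rfl⟩ := homHatMk_surjective x
  induction y using Quotient.ind with
  | _ f =>
    change homHatMk (c.transport (Iso.refl P)) (homBarMk (f ≫ 𝟙 C)) = homHatMk c (homBarMk f)
    rw [Category.comp_id]
    -- the identity transition `(c.src, c.hom ≫ 𝟙) → (c.src, c.hom)`
    let t : OneProperCover.Transition (c.transport (Iso.refl P)) c :=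
      { hom := (Iso.refl c.src).hom
        w := by
          change 𝟙 c.src ≫ c.hom = c.hom ≫ 𝟙 P
          rw [Category.id_comp, Category.comp_id]
        isOneProper := isOneProper_iso (Iso.refl c.src) }
    have h := homHatMk_precomp t (homBarMk f)
    have hx : HomBar.precomp t.hom (homBarMk f) = homBarMk (f) := by
      change homBarMk (𝟙 c.src ≫ f) = homBarMk f
      rw [Category.id_comp]
    rw [hx] at h
    exact h

/-- **`HomHat.map` is compatible with composition** of isomorphisms / morphisms.
[cite: MochizukiSemiAnbd2006, Thm A.4 proof p.84] -/
theorem HomHat.map_trans {P P' P'' C C' C'' : QDPair Q} (e : P ≅ P') (e' : P' ≅ P'') (g : C ⟶ C')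
    (g' : C' ⟶ C'') (x : HomHat P C) :
    HomHat.map (e ≪≫ e') (g ≫ g') x = HomHat.map e' g' (HomHat.map e g x) := by
  obtain ⟨⟨c, y⟩, rfl⟩ := homHatMk_surjective x
  induction y using Quotient.ind with
  | _ f =>
    change homHatMk (c.transport (e ≪≫ e')) (homBarMk (f ≫ g ≫ g')) =
      homHatMk ((c.transport e).transport e') (homBarMk ((f ≫ g) ≫ g'))
    rw [Category.assoc]
    -- the identity transition `(c.src, c.hom ≫ e ≫ e') → (c.src, (c.hom ≫ e) ≫ e')`
    let t : OneProperCover.Transition (c.transport (e ≪≫ e')) ((c.transport e).transport e') :=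
      { hom := (Iso.refl c.src).hom
        w := by
          change 𝟙 c.src ≫ (c.hom ≫ e.hom) ≫ e'.hom = c.hom ≫ (e ≪≫ e').hom
          rw [Category.id_comp, Iso.trans_hom, Category.assoc]
        isOneProper := isOneProper_iso (Iso.refl c.src) }
    have h := homHatMk_precomp t (homBarMk (f ≫ g ≫ g'))
    have hx : HomBar.precomp t.hom (homBarMk (f ≫ g ≫ g')) = homBarMk (f ≫ g ≫ g') := by
      change homBarMk (𝟙 c.src ≫ f ≫ g ≫ g') = homBarMk (f ≫ g ≫ g')
      rw [Category.id_comp]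
    rw [hx] at h
    exact h

/-- `HomHat.map e.symm (inv g)` undoes `HomHat.map e g`. [cite: MochizukiSemiAnbd2006, Thm A.4 proof p.84] -/
theorem HomHat.map_symm_map {P P' C C' : QDPair Q} (e : P ≅ P') (g : C ≅ C') (x : HomHat P C) :
    HomHat.map e.symm g.inv (HomHat.map e g.hom x) = x := by
  rw [← HomHat.map_trans, Iso.self_symm_id, Iso.hom_inv_id, HomHat.map_refl]

/-- `HomHat.map e g` undoes `HomHat.map e.symm (inv g)`. [cite: MochizukiSemiAnbd2006, Thm A.4 proof p.84] -/
theorem HomHat.map_map_symm {P P' C C' : QDPair Q} (e : P ≅ P') (g : C ≅ C') (x : HomHat P' C') :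
    HomHat.map e g.hom (HomHat.map e.symm g.inv x) = x := by
  rw [← HomHat.map_trans, Iso.symm_self_id, Iso.inv_hom_id, HomHat.map_refl]

/-- **The printed bijection `Hom^((B′, Γ_B′), (C′, Γ_C′)) ⥲ Hom^((B″, Γ_B″), (C″, Γ_C″))`** induced
by isomorphisms of QD-pairs. [cite: MochizukiSemiAnbd2006, Thm A.4 proof p.84] -/
theorem HomHat.map_bijective {P P' C C' : QDPair Q} (e : P ≅ P') (g : C ≅ C') :
    Function.Bijective (HomHat.map e g.hom) :=
  Function.bijective_iff_has_inverse.mpr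
    ⟨HomHat.map e.symm g.inv, HomHat.map_symm_map e g, HomHat.map_map_symm e g⟩

/-- The bijection as an `Equiv`. [cite: MochizukiSemiAnbd2006, Thm A.4 proof p.84] -/
def HomHat.equivOfIso {P P' C C' : QDPair Q} (e : P ≅ P') (g : C ≅ C') : HomHat P C ≃ HomHat P' C' where
  toFun := HomHat.map e g.hom
  invFun := HomHat.map e.symm g.inv
  left_inv := HomHat.map_symm_map e g
  right_inv := HomHat.map_map_symm e g

/-! ### Invariance under `Γ_B`, `Γ_C`: "independent of the choice of `γ_B`, `γ_C`" -/

/-- **INVARIANCE of `Hom^` under `Γ_B` and `Γ_C`**: for `γ ∈ Γ_B`, `δ ∈ Γ_C` acting as automorphisms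
of the QD-pairs, `HomHat.map` is the identity — `γ` lifts along each 1-proper cover to an element
`γ‴ ∈ Γ_B‴` (a transition), `γ‴ ≫ f ∼ f` and `f ≫ δ ∼ f` in `Hom̄`.  This is why the printed
bijection is "independent of the choice of `γ_B`, `γ_C`".
[cite: MochizukiSemiAnbd2006, Thm A.4 proof p.84] -/
theorem HomHat.map_autOfMem {P C : QDPair Q} {γ : Aut P.A} (hγ : γ ∈ P.Γ) {δ : Aut C.A}
    (hδ : δ ∈ C.Γ) (x : HomHat P C) :
    HomHat.map (autOfMem P γ hγ) (autOfMem C δ hδ).hom x = x := by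
  obtain ⟨⟨c, y⟩, rfl⟩ := homHatMk_surjective x
  change homHatMk (c.transport (autOfMem P γ hγ)) (HomBar.postcomp (autOfMem C δ hδ).hom y) =
    homHatMk c y
  rw [HomBar.postcomp_autOfMem hδ]
  -- lift `γ` along the 1-proper cover `c`
  obtain ⟨γ₁, hγ₁, h₁⟩ := c.isOneProper.2.1 γ hγ
  -- the transition `γ‴ : (B‴ → B ≫ γ) → (B‴ → B)`
  let t : OneProperCover.Transition (c.transport (autOfMem P γ hγ)) c :=
    { hom := (autOfMem c.src γ₁ hγ₁).hom
      w := by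
        apply Hom.ext
        change γ₁.hom ≫ c.hom.hom = c.hom.hom ≫ γ.hom
        exact h₁.symm
      isOneProper := isOneProper_iso (autOfMem c.src γ₁ hγ₁) }
  have ht : HomBar.precomp t.hom y = y := HomBar.precomp_autOfMem hγ₁ y
  rw [← homHatMk_precomp t y, ht]

/-- Invariance, source only. [cite: MochizukiSemiAnbd2006, Thm A.4 proof p.84] -/
theorem HomHat.map_autOfMem_id {P C : QDPair Q} {γ : Aut P.A} (hγ : γ ∈ P.Γ) (x : HomHat P C) :
    HomHat.map (autOfMem P γ hγ) (𝟙 C) x = x := by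
  have h := HomHat.map_autOfMem hγ C.Γ.one_mem x
  have h1 : (autOfMem C 1 C.Γ.one_mem).hom = 𝟙 C := Hom.ext rfl
  rwa [h1] at h

end QDPair

end Literature.AnabelianGeometry.SemiGraphs
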